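import Summits.RiemannHypothesis.RiemannHypothesis.Theorems.JensenLogBandArcSaddleSharp
import Summits.RiemannHypothesis.RiemannHypothesis.Theorems.JensenLogBandXiStripMajorant
import Summits.RiemannHypothesis.RiemannHypothesis.Theorems.JensenLogBandArcGlobalDescent
import Summits.RiemannHypothesis.RiemannHypothesis.Theorems.JensenLogBandArcDescentDeriv
import HarnessLib

/-!
# Sharp global descent in the bounded-radius regime, part 1: kernel and coordinates
# (BAND crux, regime R2 input F6a)

RH ladder column JENSEN, rung J-P(P3) «log band», BAND crux `XiDerivBandRealAllRates`
(stmt-RiemannHypothesis-19913) of route «JensenLogBand», line «band-one-window» (u-arc reshape,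
lead rh-jensen-prover g7) — regime-(R2) input for the assembly step (S5) and the far zone of
HOME/rh-jensen-prover/g7-work/LINE-PLAN.md §8.5. RH-FREE elementary analysis. WHAT THIS IS NOT:
nothing here bears on zeros of `ζ` or the truth of RH.

WHY (eng-2 g6 STATUS 03:58Z): in regime R2 (`h = h(n,T) ≤ 20`, so `ℓ_T = 2(n+1)/h ≥ (n+1)/10` and
`log T ≍ n`) the flank of the window integral meets the critical strip at `θ = ±π/2`, where the
convexity bound for `ζ` is `e^{(n+1)(½−x)/h}·O(ℓ)`; it is beaten only by a descent constant
`κ₁ > (½ − x)/h`, i.e. `κ₁ = 1 − o(1)` near the zone boundaries — the τ-uniform constant `17/20`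
of `log_norm_arcModelIntegrand_descent` is not enough there. In R2 the sharp constant comes for
free from the horizontal/vertical monotonicity of `‖γ̃‖` (F1, `JensenLogBandGammaFactorMonotone`)
and the sharp saddle location (F4, `JensenLogBandArcSaddleSharp`). This part:

* `circleMap_norm_arg`, `norm_sqKernel_eq`, `norm_arcModelIntegrand_eq`;
* `R2_bookkeeping` — `ε ≤ (9/25)h`, `ε ≤ 33/10`, `T ≥ 1200`, `n+1 ≤ T/6` for `ε = (2 + (16/5)h)/ℓ_T`;
* **`norm_sqKernel_le_of_mem_sphere`** — kernel comparison on the saddle circle: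
  `‖K_{n,c}(u_θ)‖ ≤ e^{h/4 + 1/20} ‖K_{n,c}(u*)‖`;
* `half_add_circleMap_eq` (coordinates of `½ + u_θ`), `ell_height_bounds` (`ℓ_t ≥ ℓ_T − 1/10`,
  `6/t ≤ 1/100` for `t ≥ T − 32`).

Part 2 (`JensenLogBandArcDescentR2.lean`): the `γ̃`-comparison along the arc and the descent
`‖I_r(θ)‖ ≤ e^{6h+2}‖I_r(φ₀)‖e^{−(n+1)(cos φ₀ − cos θ)}`. Regime: `|x| ≤ ½`, `T ≥ 100`, `ℓ_T ≥ 20`,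
`n ≥ 100`, `½ ≤ h ≤ (7/20)T`, **`h ≤ 20`**. (prover-rh-jensen-eng-2-g6-0, 2026-08-27.)
-/

noncomputable section

-- single-problem summit: `Summit.RiemannHypothesis.RiemannHypothesis.…` is the tree convention
set_option linter.dupNamespace false

open Complex Real Set

namespace Summit.RiemannHypothesis.RiemannHypothesis.Theorems.JensenPolynomials.LogBandArc

open Literature.NumberTheory.LFunctions

variable {n : ℕ} {x T : ℝ} {u : ℂ}

/-! ## Elementary pieces -/

/-- The saddle circle through `u*`: `circleMap c ‖u* − c‖ (arg(u* − c)) = u*`. [folklore] -/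
theorem circleMap_norm_arg (c u : ℂ) : circleMap c ‖u - c‖ (Complex.arg (u - c)) = u := by
  rw [circleMap, Complex.norm_mul_exp_arg_mul_I]; ring

/-- `‖K_{n,c}(u)‖ = 2‖u‖ / (‖u − c‖ ‖u + c‖)^{n+1}`. [folklore] -/
theorem norm_sqKernel_eq (n : ℕ) (c u : ℂ) :
    ‖sqKernel n c u‖ = 2 * ‖u‖ / (‖u - c‖ * ‖u + c‖) ^ (n + 1) := by
  rw [sqKernel, norm_mul, norm_mul, norm_inv, norm_pow, show u ^ 2 - c ^ 2 = (u - c) * (u + c) by ring,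
    norm_mul, Complex.norm_ofNat, div_eq_mul_inv]

/-- `‖I_r(θ)‖ = |r| · ‖γ̃(½ + u_θ)‖ · ‖K_{n,c}(u_θ)‖`. [folklore] -/
theorem norm_arcModelIntegrand_eq (n : ℕ) (r : ℝ) (c : ℂ) (θ : ℝ) :
    ‖arcModelIntegrand n r c θ‖ =
      |r| * (‖xiGammaFactor (1 / 2 + circleMap c r θ)‖ * ‖sqKernel n c (circleMap c r θ)‖) := by
  rw [arcModelIntegrand, norm_mul, norm_mul, deriv_circleMap_eq_I_mul_sub, norm_mul, Complex.norm_I,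
    one_mul, circleMap_sub_center, norm_circleMap_zero]

/-! ## Regime R2: numeric consequences -/

/-- **R2 bookkeeping.** With `ε := (2 + (16/5)h)/ℓ_T` (F4), in the regime `ℓ_T ≥ 20`, `½ ≤ h ≤ 20`,
`T ≥ 100`: `ε ℓ_T ≤ (36/5) h`, `ε ≤ (9/25) h`, `ε ≤ 33/10`, `T ≥ 1200`, `n + 1 ≤ T/6`. [folklore] -/
theorem R2_bookkeeping (hT : 100 ≤ T) (hℓ : 20 ≤ ell T) (hh : 1 / 2 ≤ bandRadius n T)
    (hH : bandRadius n T ≤ 20) :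
    (2 + 16 / 5 * bandRadius n T) / ell T * ell T ≤ 36 / 5 * bandRadius n T ∧
    (2 + 16 / 5 * bandRadius n T) / ell T ≤ 9 / 25 * bandRadius n T ∧
    (2 + 16 / 5 * bandRadius n T) / ell T ≤ 33 / 10 ∧
    1200 ≤ T ∧ (n : ℝ) + 1 ≤ T / 6 := by
  set h := bandRadius n T
  set ℓ := ell T
  have hℓ0 : 0 < ℓ := by linarith
  have hhℓ : h * ℓ = 2 * ((n : ℝ) + 1) := bandRadius_mul_ell hℓ
  have h60 := sixty_mul_ell_le hT hℓ
  refine ⟨?_, ?_, ?_, by linarith, by nlinarith⟩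
  · rw [div_mul_cancel₀ _ hℓ0.ne']; linarith
  · rw [div_le_iff₀ hℓ0]; nlinarith
  · rw [div_le_iff₀ hℓ0]; nlinarith

/-! ## Kernel comparison on the saddle circle -/

set_option maxHeartbeats 400000 in -- long chain of explicit estimates in a large context, no search
/-- **Kernel comparison on one circle about `c`:** for two points `u₁, u₂` with
`‖u₁ − c‖ = ‖u₂ − c‖ = r`, `‖K(u₁)‖ ≤ (1 + 2r/‖u₂‖)(1 + 2r/‖u₁ + c‖)^{n+1} · ‖K(u₂)‖` — here in the
quantitative R2 form `‖K(u_θ)‖ ≤ e^{h/4 + 1/20} ‖K(u*)‖` on the saddle circle. [folklore] -/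
theorem norm_sqKernel_le_of_mem_sphere (hx : |x| ≤ 1 / 2) (hT : 100 ≤ T)
    (hℓ : 20 ≤ ell T) (hn : 100 ≤ n) (hh : 1 / 2 ≤ bandRadius n T)
    (hhT : bandRadius n T ≤ 7 / 20 * T) (hH : bandRadius n T ≤ 20)
    (hu : ‖u - ((x : ℂ) + (T : ℂ) * I + bandRadius n T)‖ ≤ 3 / 5 * bandRadius n T)
    (hS : arcSaddleFn n ((x : ℂ) + (T : ℂ) * I) u = 0) (θ : ℝ) :
    ‖sqKernel n ((x : ℂ) + (T : ℂ) * I)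
        (circleMap ((x : ℂ) + (T : ℂ) * I) ‖u - ((x : ℂ) + (T : ℂ) * I)‖ θ)‖ ≤
      Real.exp (bandRadius n T / 4 + 1 / 20) * ‖sqKernel n ((x : ℂ) + (T : ℂ) * I) u‖ := by
  -- all facts first, then generalize the composite terms to opaque names
  obtain ⟨-, hεh, hε33, hT1200, hnT⟩ := R2_bookkeeping hT hℓ hh hH
  obtain ⟨-, him_abs, hr_lo, hr_hi⟩ := arcSaddle_sharp_polar hx hT hℓ hn hh hhT hH hu hS
  have hcim : ((x : ℂ) + (T : ℂ) * I).im = T := by simp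
  have hwc : ‖circleMap ((x : ℂ) + (T : ℂ) * I) ‖u - ((x : ℂ) + (T : ℂ) * I)‖ θ -
      ((x : ℂ) + (T : ℂ) * I)‖ = ‖u - ((x : ℂ) + (T : ℂ) * I)‖ := by
    rw [circleMap_sub_center, norm_circleMap_zero, abs_of_nonneg (norm_nonneg _)]
  have hwim := (circleMap_sub_re_im ((x : ℂ) + (T : ℂ) * I) ‖u - ((x : ℂ) + (T : ℂ) * I)‖ θ).2
  generalize hε' : (2 + 16 / 5 * bandRadius n T) / ell T = ε at *
  generalize hh' : bandRadius n T = h at *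
  generalize hc' : ((x : ℂ) + (T : ℂ) * I) = c at *
  generalize hr' : ‖u - c‖ = r at *
  generalize hw' : circleMap c r θ = w at *
  rw [norm_sqKernel_eq, norm_sqKernel_eq, hwc, hr']
  have hh0 : 0 < h := by linarith
  have hr0 : 0 < r := by linarith
  have hr28 : r ≤ 28 := by linarith
  have hsin := Real.neg_one_le_sin θ
  -- `‖u‖ ≥ T − 33/10`, `‖w‖ ≤ ‖u‖ + 2r ≤ e^{1/20} ‖u‖`
  have hu_im : T - 33 / 10 ≤ u.im := by
    have e : (u - c).im = u.im - T := by rw [Complex.sub_im, hcim]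
    have h1 := (abs_le.1 him_abs).1
    rw [e] at h1; linarith
  have hu_norm : T - 33 / 10 ≤ ‖u‖ := by
    have := Complex.abs_im_le_norm u
    rw [abs_of_pos (by linarith)] at this; linarith
  have hdiff : ‖w - u‖ ≤ 2 * r := by
    have e : w - u = (w - c) - (u - c) := by ring
    rw [e]
    have := norm_sub_le (w - c) (u - c)
    rw [hwc, hr'] at this; linarith
  have hwu : ‖w‖ ≤ ‖u‖ + 2 * r := by
    have := norm_add_le u (w - u)
    rw [show u + (w - u) = w by ring] at this; linarith
  have hF1 : ‖w‖ ≤ Real.exp (1 / 20) * ‖u‖ := by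
    have h1 : ‖w‖ ≤ (1 + 1 / 20) * ‖u‖ := by nlinarith
    have h2 : (1 + 1 / 20 : ℝ) ≤ Real.exp (1 / 20) := by
      have := Real.add_one_le_exp (1 / 20 : ℝ); linarith
    have h3 : 0 ≤ ‖u‖ := norm_nonneg _
    nlinarith
  -- `‖u + c‖^{n+1} ≤ e^{h/4} ‖w + c‖^{n+1}`
  have hwc_im : 2 * T - 28 ≤ (w + c).im := by
    have e : (w + c).im = (w - c).im + 2 * T := by rw [Complex.add_im, Complex.sub_im, hcim]; ring
    rw [e, hwim]; nlinarith
  have hwc_norm : 2 * T - 28 ≤ ‖w + c‖ := by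
    have := Complex.abs_im_le_norm (w + c)
    rw [abs_of_pos (by linarith)] at this; linarith
  have hwc0 : 0 < ‖w + c‖ := by linarith
  have huc_le : ‖u + c‖ ≤ ‖w + c‖ + 2 * r := by
    have := norm_add_le (w + c) (u - w)
    rw [show (w + c) + (u - w) = u + c by ring, norm_sub_rev] at this; linarith
  have huc0 : 0 < ‖u + c‖ := by
    have := norm_sub_norm_le (w + c) (w - u)
    rw [show (w + c) - (w - u) = u + c by ring] at this; linarith
  have hratio : ‖u + c‖ ≤ (1 + 2 * r / ‖w + c‖) * ‖w + c‖ := by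
    rw [add_mul, one_mul, div_mul_cancel₀ _ hwc0.ne']; exact huc_le
  have hpow : ‖u + c‖ ^ (n + 1) ≤ Real.exp (h / 4) * ‖w + c‖ ^ (n + 1) := by
    have h1 : ‖u + c‖ ^ (n + 1) ≤ ((1 + 2 * r / ‖w + c‖) * ‖w + c‖) ^ (n + 1) :=
      pow_le_pow_left₀ (norm_nonneg _) hratio _
    rw [mul_pow] at h1
    have ha : 0 ≤ 2 * r / ‖w + c‖ := by positivity
    -- `(1 + a)^{n+1} ≤ e^{(n+1) a}` (cf. `RSTProj.one_add_pow_le_exp` in the Computability corner)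
    have h2 : (1 + 2 * r / ‖w + c‖) ^ (n + 1) ≤ Real.exp (((n + 1 : ℕ) : ℝ) * (2 * r / ‖w + c‖)) := by
      calc (1 + 2 * r / ‖w + c‖) ^ (n + 1) ≤ (Real.exp (2 * r / ‖w + c‖)) ^ (n + 1) := by
            apply pow_le_pow_left₀ (by positivity)
            have := Real.add_one_le_exp (2 * r / ‖w + c‖); linarith only [this]
        _ = Real.exp (((n + 1 : ℕ) : ℝ) * (2 * r / ‖w + c‖)) := by rw [← Real.exp_nat_mul]
    have h3 : ((n + 1 : ℕ) : ℝ) * (2 * r / ‖w + c‖) ≤ h / 4 := by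
      push_cast
      rw [mul_div_assoc', div_le_iff₀ hwc0]
      have e1 : ((n : ℝ) + 1) * (2 * r) ≤ T / 6 * (2 * r) :=
        mul_le_mul_of_nonneg_right hnT (by linarith)
      have e2 : T / 6 * (2 * r) ≤ T / 6 * (2 * (34 / 25 * h)) :=
        mul_le_mul_of_nonneg_left (by linarith) (by linarith)
      have e3 : h / 4 * (2 * T - 28) ≤ h / 4 * ‖w + c‖ :=
        mul_le_mul_of_nonneg_left hwc_norm (by linarith)
      have e4 : 1200 * h ≤ h * T := by nlinarith
      have e5 : T / 6 * (2 * (34 / 25 * h)) = 68 / 150 * (h * T) := by ring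
      have e6 : h / 4 * (2 * T - 28) = 1 / 2 * (h * T) - 7 * h := by ring
      linarith
    have h4 : Real.exp (((n + 1 : ℕ) : ℝ) * (2 * r / ‖w + c‖)) ≤ Real.exp (h / 4) :=
      Real.exp_le_exp.2 h3
    exact h1.trans (mul_le_mul_of_nonneg_right (h2.trans h4) (by positivity))
  -- assemble with `A := (r‖w+c‖)^{n+1}`, `B := (r‖u+c‖)^{n+1}`
  have hA0 : 0 < (r * ‖w + c‖) ^ (n + 1) := by positivity
  have hB0 : 0 < (r * ‖u + c‖) ^ (n + 1) := by positivity
  have hBA : (r * ‖u + c‖) ^ (n + 1) ≤ Real.exp (h / 4) * (r * ‖w + c‖) ^ (n + 1) := by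
    rw [mul_pow, mul_pow, ← mul_assoc, mul_comm (Real.exp _) (r ^ (n + 1)), mul_assoc]
    exact mul_le_mul_of_nonneg_left hpow (by positivity)
  -- make the two powers opaque
  generalize hA' : (r * ‖w + c‖) ^ (n + 1) = A at hA0 hBA ⊢
  generalize hB' : (r * ‖u + c‖) ^ (n + 1) = B at hB0 hBA ⊢
  have hu0 : 0 ≤ ‖u‖ := norm_nonneg _
  have he1 : 0 < Real.exp (1 / 20) := Real.exp_pos _
  have he2 : 0 < Real.exp (h / 4) := Real.exp_pos _
  have h1A : 1 / A ≤ Real.exp (h / 4) / B := by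
    rw [div_le_div_iff₀ hA0 hB0, one_mul]; exact hBA
  have s1 : 2 * ‖w‖ * (1 / A) ≤ 2 * (Real.exp (1 / 20) * ‖u‖) * (1 / A) :=
    mul_le_mul_of_nonneg_right (by linarith only [hF1]) (by positivity)
  have s2 : 2 * (Real.exp (1 / 20) * ‖u‖) * (1 / A) ≤
      2 * (Real.exp (1 / 20) * ‖u‖) * (Real.exp (h / 4) / B) :=
    mul_le_mul_of_nonneg_left h1A (by positivity)
  have e1 : 2 * ‖w‖ / A = 2 * ‖w‖ * (1 / A) := by ring
  have e2 : 2 * (Real.exp (1 / 20) * ‖u‖) * (Real.exp (h / 4) / B) =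
      Real.exp (h / 4 + 1 / 20) * (2 * ‖u‖ / B) := by rw [Real.exp_add]; ring
  rw [e1, ← e2]
  exact s1.trans s2

/-! ## Coordinates along the saddle circle -/

/-- Coordinates of a point of the circle `u = c + r e^{iθ}`, `c = x + iT`:
`½ + u = (½ + x + r cos θ) + i (T + r sin θ)`. [folklore] -/
theorem half_add_circleMap_eq (x T r θ : ℝ) :
    (1 / 2 : ℂ) + circleMap ((x : ℂ) + (T : ℂ) * I) r θ =
      ((1 / 2 + x + r * Real.cos θ : ℝ) : ℂ) + ((T + r * Real.sin θ : ℝ) : ℂ) * I := by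
  obtain ⟨hre, him⟩ := circleMap_sub_re_im ((x : ℂ) + (T : ℂ) * I) r θ
  apply Complex.ext
  · simp only [Complex.add_re, Complex.ofReal_re, Complex.mul_re, Complex.I_re, Complex.I_im,
      Complex.ofReal_im, mul_zero, mul_one, sub_zero]
    rw [Complex.sub_re] at hre
    simp at hre
    norm_num; linarith
  · simp only [Complex.add_im, Complex.ofReal_im, Complex.mul_im, Complex.I_re, Complex.I_im,
      Complex.ofReal_re, mul_zero, mul_one, zero_add, add_zero]
    rw [Complex.sub_im] at him
    simp at him
    norm_num; linarith

/-- `ℓ_{t} ≥ ℓ_T − 1/10` and `6/t ≤ 1/100` for heights `t ≥ T − 32`, `T ≥ 1200`. [folklore] -/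
theorem ell_height_bounds {T t : ℝ} (hT : 1200 ≤ T) (ht : T - 32 ≤ t) :
    ell T - 1 / 10 ≤ ell t ∧ 6 / t ≤ 1 / 100 := by
  have hT0 : 0 < T := by linarith
  have ht0 : 0 < t := by linarith
  constructor
  · have e : ell t - ell T = Real.log (t / T) := by
      rw [ell, ell, ← Real.log_div (by positivity) (by positivity)]
      congr 1; field_simp
    have h1 : 1 - (t / T)⁻¹ ≤ Real.log (t / T) := Real.one_sub_inv_le_log_of_pos (by positivity)
    rw [inv_div] at h1
    have h2 : T / t ≤ 1 + 1 / 10 := by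
      rw [div_le_iff₀ ht0]; linarith
    linarith
  · rw [div_le_iff₀ ht0]; linarith

/-! ## The cost of the saddle angle -/

/-- **The saddle angle costs a constant:** `(n+1)(1 − cos φ₀) ≤ 22/25 + (141/100) h` in regime R2
(`(n+1) sin² φ₀ = (hℓ/2)(Im(u*−c))²/r² ≤ (hℓ/2) ε²/r²`, `εℓ = 2 + 16h/5`, `ε ≤ 9h/25`, `r ≥ 16h/25`).
[folklore] -/
theorem saddle_angle_cost (hx : |x| ≤ 1 / 2) (hT : 100 ≤ T)
    (hℓ : 20 ≤ ell T) (hn : 100 ≤ n) (hh : 1 / 2 ≤ bandRadius n T)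
    (hhT : bandRadius n T ≤ 7 / 20 * T) (hH : bandRadius n T ≤ 20)
    (hu : ‖u - ((x : ℂ) + (T : ℂ) * I + bandRadius n T)‖ ≤ 3 / 5 * bandRadius n T)
    (hS : arcSaddleFn n ((x : ℂ) + (T : ℂ) * I) u = 0) :
    ((n : ℝ) + 1) * (1 - Real.cos (Complex.arg (u - ((x : ℂ) + (T : ℂ) * I)))) ≤
      22 / 25 + 141 / 100 * bandRadius n T := by
  obtain ⟨-, hεh, hε33, hT1200, -⟩ := R2_bookkeeping hT hℓ hh hH
  obtain ⟨hre_lo, him_abs, hr_lo, hr_hi⟩ := arcSaddle_sharp_polar hx hT hℓ hn hh hhT hH hu hS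
  have hℓ0 : 0 < ell T := by linarith
  have hεℓ : (2 + 16 / 5 * bandRadius n T) / ell T * ell T = 2 + 16 / 5 * bandRadius n T :=
    div_mul_cancel₀ _ hℓ0.ne'
  have hhℓ : bandRadius n T * ell T = 2 * ((n : ℝ) + 1) := bandRadius_mul_ell hℓ
  have hu_eq : circleMap ((x : ℂ) + (T : ℂ) * I) ‖u - ((x : ℂ) + (T : ℂ) * I)‖
      (Complex.arg (u - ((x : ℂ) + (T : ℂ) * I))) = u := circleMap_norm_arg _ u
  obtain ⟨hure, huim⟩ := circleMap_sub_re_im ((x : ℂ) + (T : ℂ) * I) ‖u - ((x : ℂ) + (T : ℂ) * I)‖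
    (Complex.arg (u - ((x : ℂ) + (T : ℂ) * I)))
  rw [hu_eq] at hure huim
  generalize hε' : (2 + 16 / 5 * bandRadius n T) / ell T = ε at *
  generalize hh' : bandRadius n T = h at *
  generalize hℓ' : ell T = ℓ at *
  generalize hφ' : Complex.arg (u - ((x : ℂ) + (T : ℂ) * I)) = φ₀ at *
  generalize hr' : ‖u - ((x : ℂ) + (T : ℂ) * I)‖ = r at *
  have hh0 : 0 < h := by linarith only [hh]
  have hr0 : 0 < r := by linarith only [hr_lo, hεh, hh0]
  have hrlo' : 16 / 25 * h ≤ r := by linarith only [hr_lo, hεh]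
  have hcos0 : 0 < Real.cos φ₀ := by
    have h1 : 0 < r * Real.cos φ₀ := by rw [← hure]; linarith only [hre_lo, hh0, hεh]
    exact pos_of_mul_pos_right h1 hr0.le
  have hcos01 : Real.cos φ₀ ≤ 1 := Real.cos_le_one φ₀
  have him_le : |r * Real.sin φ₀| ≤ ε := by rw [← huim]; exact him_abs
  have hcc : Real.cos φ₀ * Real.cos φ₀ ≤ Real.cos φ₀ := mul_le_of_le_one_left hcos0.le hcos01
  have h1 : 1 - Real.cos φ₀ ≤ Real.sin φ₀ ^ 2 := by
    have hs : Real.sin φ₀ ^ 2 = 1 - Real.cos φ₀ ^ 2 := by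
      linarith only [Real.sin_sq_add_cos_sq φ₀]
    rw [hs, pow_two]; linarith only [hcc]
  have hn1 : ((n : ℝ) + 1) = h * ℓ / 2 := by linarith only [hhℓ]
  have h2 : ((n : ℝ) + 1) * (1 - Real.cos φ₀) ≤ (h * ℓ / 2) * Real.sin φ₀ ^ 2 := by
    rw [hn1]; exact mul_le_mul_of_nonneg_left h1 (by positivity)
  -- `r² sin² φ₀ ≤ ε²`
  have h3 : r ^ 2 * Real.sin φ₀ ^ 2 ≤ ε ^ 2 := by
    rw [← mul_pow]
    have := pow_le_pow_left₀ (abs_nonneg _) him_le 2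
    rwa [sq_abs] at this
  -- `(hℓ/2) sin² · (16h/25)² ≤ (hℓ/2) sin² · r² ≤ (hℓ/2) ε² = (2 + 16h/5) ε h/2 ≤ (2+16h/5)(9h/25)h/2`
  have hS0 : 0 ≤ (h * ℓ / 2) * Real.sin φ₀ ^ 2 := by positivity
  have hr2 : (16 / 25 * h) ^ 2 ≤ r ^ 2 := pow_le_pow_left₀ (by positivity) hrlo' 2
  have a1 : (h * ℓ / 2) * Real.sin φ₀ ^ 2 * (16 / 25 * h) ^ 2 ≤
      (h * ℓ / 2) * Real.sin φ₀ ^ 2 * r ^ 2 := mul_le_mul_of_nonneg_left hr2 hS0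
  have a2 : (h * ℓ / 2) * Real.sin φ₀ ^ 2 * r ^ 2 ≤ (h * ℓ / 2) * ε ^ 2 := by
    have := mul_le_mul_of_nonneg_left h3 (show 0 ≤ h * ℓ / 2 by positivity)
    have e : (h * ℓ / 2) * Real.sin φ₀ ^ 2 * r ^ 2 = (h * ℓ / 2) * (r ^ 2 * Real.sin φ₀ ^ 2) := by
      ring
    linarith only [this, e]
  have a3 : (h * ℓ / 2) * ε ^ 2 = (2 + 16 / 5 * h) * ε * h / 2 := by
    have e : (h * ℓ / 2) * ε ^ 2 = (ε * ℓ) * ε * h / 2 := by ring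
    rw [e, hεℓ]
  have a4 : (2 + 16 / 5 * h) * ε * h / 2 ≤ (2 + 16 / 5 * h) * (9 / 25 * h) * h / 2 := by
    have := mul_le_mul_of_nonneg_left hεh (show 0 ≤ (2 + 16 / 5 * h) * h / 2 by positivity)
    linarith only [this]
  have a5 : (h * ℓ / 2) * Real.sin φ₀ ^ 2 * (16 / 25 * h) ^ 2 ≤
      ((2 + 16 / 5 * h) * (9 / 25) * (625 / 512)) * (16 / 25 * h) ^ 2 := by
    have e : (2 + 16 / 5 * h) * (9 / 25 * h) * h / 2 =
        ((2 + 16 / 5 * h) * (9 / 25) * (625 / 512)) * (16 / 25 * h) ^ 2 := by ring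
    linarith only [a1, a2, a3, a4, e]
  have hpos : 0 < (16 / 25 * h) ^ 2 := by positivity
  have h7 : (h * ℓ / 2) * Real.sin φ₀ ^ 2 ≤ (2 + 16 / 5 * h) * (9 / 25) * (625 / 512) :=
    le_of_mul_le_mul_right a5 hpos
  linarith only [h2, h7, hh0.le]

end Summit.RiemannHypothesis.RiemannHypothesis.Theorems.JensenPolynomials.LogBandArc

end
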